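import Mathlib
import HarnessLib
import Literature.Analysis.FluidPDE.VectorCalculus
import Summits.NavierStokesRegularity.NavierStokesRegularity.Theorems.UnthreadedRigidityDoorUnthreadedRigidityVirialHornDefs

/-!
# Route `UnthreadedRigidityDoor`, item `UnthreadedRigidity` (W2, stmt-NavierStokesRegularity-27585) — LINE g11-1 «VIRIAL HORN»:
# the ℝ³ frame algebra behind the ANGULAR LEMMA S-C in every degree (pointwise jet identities, no calculus)

Prover file (engine-1 g71, free prover hand; `--supports stmt-NavierStokesRegularity-27585 --as helper`) for LINE g11-1 «VIRIAL HORN»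
of planner ns-idea-6 g11 (objects BY NAME in `Theorems/UnthreadedRigidityDoorUnthreadedRigidityVirialHornDefs.lean`, p695782).

THE MECHANISM (S-C `AngularLemma`, all degrees).  For a solid harmonic `Y` write, at a point `y`, `g = ∇Y(y)`, `S = Hess Y(y)`,
`T = D³Y(y)` (as `v ↦ D(Hess Y)[v]`), `R = y × g` (the rotation field `{Y,·}`), `ρ = ‖R‖²`, `τ = R × y = ‖y‖² g − ⟪y,g⟫ y`
(so `y ⟂ τ ⟂ R ⟂ y` exactly).  The angular form is `{Y,|∇Y|²} = 2⟪R, S g⟫`.  If it vanishes identically then, together with the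
Euler identities (`⟪y,g⟫ = lY`, `S y = (l−1) g`, `T y = (l−2) S`), `tr S = 0`, `tr T(v) = 0` and the two first derivatives of the
angular form along `v = g` and `v = R`, one gets at every point with `R ≠ 0`:
* `S R = −c R`, `c := −⟪S R, R⟫/ρ` (the rotation field is a Hessian eigenvector);
* for the AXIS FIELD `A := g + c y` (the axis of the osculating circle of the level curve of `Y|_{S²}`, rewritten with `ΔY = 0`)
  and its derivative `A′v = S v + (dc·v) y + c v` (quotient rule for `c`): `A′v × A = 0` for every `v` —
  along `R` this is `D³Y(R,R,R) = 0` (the level curves are circles), along `τ` it is the Riccati law of parallel circles.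
This file proves exactly that POINTWISE statement (`cross_axisDeriv_axis_eq_zero`) from the listed scalar/vector relations, by
resolving every vector in the orthogonal frame `{y, τ, R}`; the calculus (jets of a solid harmonic, constancy of `A/‖A‖` on a ball,
identity principle) is in `…VirialHornAngularLemma.lean`.

HONEST LABEL: linear algebra in `ℝ³` about SPECIAL separable data (support S-C of a RUNG line); `UnthreadedRigidity` (27585), W2 and NS
regularity remain OPEN; nothing here is a statement about the Navier–Stokes equations.  0 kit.
-/

-- the summit and its single sub-problem share the name (CONVENTIONS §1), as in every Theorems file
set_option linter.dupNamespace false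

namespace Summit.NavierStokesRegularity.NavierStokesRegularity.Theorems.UnthreadedRigidity.VirialHorn

open scoped InnerProductSpace
open Literature.Analysis.FluidPDE (cross)
open Summit.NavierStokesRegularity.NavierStokesRegularity.Theorems.UnthreadedRigidity.ProfileHorn (E3)

/-! ## Coordinates -/

/-- components of the cross product. -/
private theorem cross_apply_zero (u v : E3) : cross u v 0 = u 1 * v 2 - u 2 * v 1 := by
  simp [cross, cross_apply]

/-- components of the cross product. -/
private theorem cross_apply_one (u v : E3) : cross u v 1 = u 2 * v 0 - u 0 * v 2 := by
  simp [cross, cross_apply]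

/-- components of the cross product. -/
private theorem cross_apply_two (u v : E3) : cross u v 2 = u 0 * v 1 - u 1 * v 0 := by
  simp [cross, cross_apply]

/-- the inner product in coordinates. -/
private theorem real_inner_e3 (u v : E3) : ⟪u, v⟫_ℝ = u 0 * v 0 + u 1 * v 1 + u 2 * v 2 := by
  simp [PiLp.inner_apply, Fin.sum_univ_three, mul_comm]

/-- `det[a,b,c] = ⟪a, b × c⟫`. -/
theorem det3_eq_inner_cross (a b c : E3) : det3 a b c = ⟪a, cross b c⟫_ℝ := by
  rw [real_inner_e3, cross_apply_zero, cross_apply_one, cross_apply_two, det3]; ring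

/-- `det[a,b,c] = ⟪a × b, c⟫`. -/
theorem det3_eq_inner_cross_left (a b c : E3) : det3 a b c = ⟪cross a b, c⟫_ℝ := by
  rw [real_inner_e3, cross_apply_zero, cross_apply_one, cross_apply_two, det3]; ring

/-! ## Cross-product identities (coordinate proofs) -/

section CrossAlgebra

/-- anticommutativity. -/
private theorem cross_anticomm' (u v : E3) : cross v u = -cross u v := by
  ext i
  fin_cases i <;> simp [cross_apply_zero, cross_apply_one, cross_apply_two] <;> ring

/-- `u × u = 0`. -/
private theorem cross_self' (u : E3) : cross u u = 0 := by
  ext i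
  fin_cases i <;> simp [cross_apply_zero, cross_apply_one, cross_apply_two] <;> ring

/-- additivity in the first slot. -/
private theorem cross_add_left' (u v w : E3) : cross (u + v) w = cross u w + cross v w := by
  ext i
  fin_cases i <;> simp [cross_apply_zero, cross_apply_one, cross_apply_two] <;> ring

/-- additivity in the second slot. -/
private theorem cross_add_right' (u v w : E3) : cross u (v + w) = cross u v + cross u w := by
  ext i
  fin_cases i <;> simp [cross_apply_zero, cross_apply_one, cross_apply_two] <;> ring

/-- homogeneity in the first slot. -/
private theorem cross_smul_left' (c : ℝ) (u v : E3) : cross (c • u) v = c • cross u v := by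
  ext i
  fin_cases i <;> simp [cross_apply_zero, cross_apply_one, cross_apply_two] <;> ring

/-- homogeneity in the second slot. -/
private theorem cross_smul_right' (c : ℝ) (u v : E3) : cross u (c • v) = c • cross u v := by
  ext i
  fin_cases i <;> simp [cross_apply_zero, cross_apply_one, cross_apply_two] <;> ring

/-- `u × (v × w) = ⟪u,w⟫ v − ⟪u,v⟫ w`. -/
private theorem cross_cross_eq (u v w : E3) : cross u (cross v w) = ⟪u, w⟫_ℝ • v - ⟪u, v⟫_ℝ • w := by
  ext i
  fin_cases i <;> simp [cross_apply_zero, cross_apply_one, cross_apply_two, real_inner_e3] <;> ring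

/-- `(u × v) × w = ⟪u,w⟫ v − ⟪v,w⟫ u`. -/
private theorem cross_cross_eq_left (u v w : E3) : cross (cross u v) w = ⟪u, w⟫_ℝ • v - ⟪v, w⟫_ℝ • u := by
  ext i
  fin_cases i <;> simp [cross_apply_zero, cross_apply_one, cross_apply_two, real_inner_e3] <;> ring

/-- `⟪u × v, u⟫ = 0`. -/
private theorem inner_cross_self_fst (u v : E3) : ⟪cross u v, u⟫_ℝ = 0 := by
  rw [real_inner_e3, cross_apply_zero, cross_apply_one, cross_apply_two]; ring

/-- `⟪u × v, v⟫ = 0`. -/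
private theorem inner_cross_self_snd (u v : E3) : ⟪cross u v, v⟫_ℝ = 0 := by
  rw [real_inner_e3, cross_apply_zero, cross_apply_one, cross_apply_two]; ring

/-- cyclicity of the triple product: `⟪u × v, w⟫ = ⟪v × w, u⟫`. -/
private theorem inner_cross_cyclic (u v w : E3) : ⟪cross u v, w⟫_ℝ = ⟪cross v w, u⟫_ℝ := by
  rw [real_inner_e3, real_inner_e3, cross_apply_zero, cross_apply_one, cross_apply_two,
    cross_apply_zero, cross_apply_one, cross_apply_two]; ring

/-- `⟪u × v, w⟫ = ⟪u, v × w⟫`. -/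
private theorem inner_cross_assoc (u v w : E3) : ⟪cross u v, w⟫_ℝ = ⟪u, cross v w⟫_ℝ := by
  rw [real_inner_e3, real_inner_e3, cross_apply_zero, cross_apply_one, cross_apply_two,
    cross_apply_zero, cross_apply_one, cross_apply_two]; ring

/-- Lagrange's identity `‖u × v‖² = ‖u‖²‖v‖² − ⟪u,v⟫²` in inner-product form. -/
private theorem inner_cross_self_eq (u v : E3) :
    ⟪cross u v, cross u v⟫_ℝ = ⟪u, u⟫_ℝ * ⟪v, v⟫_ℝ - ⟪u, v⟫_ℝ ^ 2 := by
  simp only [real_inner_e3, cross_apply_zero, cross_apply_one, cross_apply_two]; ring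

end CrossAlgebra

/-! ## The orthogonal frame `{y, τ, R}`, `R = y × g`, `τ = R × y` -/

section Frame

variable (y g : E3)

/-- `τ = R × y = ‖y‖² g − ⟪y,g⟫ y`. -/
theorem frame_tau_eq : cross (cross y g) y = ⟪y, y⟫_ℝ • g - ⟪y, g⟫_ℝ • y := by
  rw [cross_cross_eq_left, real_inner_comm g y]

/-- `⟪τ, g⟫ = ‖R‖²`. -/
theorem inner_tau_g : ⟪cross (cross y g) y, g⟫_ℝ = ⟪cross y g, cross y g⟫_ℝ := by
  rw [frame_tau_eq, inner_sub_left, inner_smul_left, inner_smul_left, inner_cross_self_eq,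
    real_inner_comm g y]
  simp; ring

/-- `⟪τ, τ⟫ = ‖y‖² ‖R‖²`. -/
theorem inner_tau_tau : ⟪cross (cross y g) y, cross (cross y g) y⟫_ℝ = ⟪y, y⟫_ℝ * ⟪cross y g, cross y g⟫_ℝ := by
  rw [inner_cross_self_eq (cross y g) y, inner_cross_self_fst, inner_cross_self_eq]; ring

/-- `y × τ = ‖y‖² R`. -/
theorem cross_y_tau : cross y (cross (cross y g) y) = ⟪y, y⟫_ℝ • cross y g := by
  rw [real_inner_e3]
  ext i
  fin_cases i <;>
    simp [cross_apply_zero, cross_apply_one, cross_apply_two] <;> ring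

/-- `τ × R = ‖R‖² y`. -/
theorem cross_tau_R : cross (cross (cross y g) y) (cross y g) = ⟪cross y g, cross y g⟫_ℝ • y := by
  rw [real_inner_e3, cross_apply_zero, cross_apply_one, cross_apply_two]
  ext i
  fin_cases i <;>
    simp [cross_apply_zero, cross_apply_one, cross_apply_two] <;> ring

/-- cross product of two combinations of the same pair of vectors. -/
private theorem cross_lincomb (a₁ b₁ a₂ b₂ : ℝ) (u w : E3) :
    cross (a₁ • u + b₁ • w) (a₂ • u + b₂ • w) = (a₁ * b₂ - b₁ * a₂) • cross u w := by
  ext i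
  fin_cases i <;>
    simp [cross_apply_zero, cross_apply_one, cross_apply_two] <;> ring

/-- `⟪v, eᵢ⟫ = vᵢ`. -/
private theorem inner_e_right (v : E3) (i : Fin 3) : ⟪v, e i⟫_ℝ = v i := by
  simp [e, EuclideanSpace.inner_single_right]

/-- RESOLUTION OF THE IDENTITY in the frame `{y, τ, R}` (an exact polynomial identity):
`‖y‖²‖R‖² X = ‖R‖²⟪X,y⟫ y + ⟪X,τ⟫ τ + ‖y‖²⟪X,R⟫ R`. -/
theorem frame_resolution (X : E3) :
    (⟪y, y⟫_ℝ * ⟪cross y g, cross y g⟫_ℝ) • X =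
      (⟪cross y g, cross y g⟫_ℝ * ⟪X, y⟫_ℝ) • y + ⟪X, cross (cross y g) y⟫_ℝ • cross (cross y g) y
        + (⟪y, y⟫_ℝ * ⟪X, cross y g⟫_ℝ) • cross y g := by
  ext i
  fin_cases i <;>
    simp only [real_inner_e3, cross_apply_zero, cross_apply_one, cross_apply_two, PiLp.add_apply,
      PiLp.smul_apply, smul_eq_mul] <;> simp [cross_apply_zero, cross_apply_one, cross_apply_two] <;> ring

/-- a linear map in coordinates (cf. `clm_apply_coord` of `…VirialHornZonal`). -/
private theorem clm_apply_coord' (M : E3 →L[ℝ] E3) (u : E3) (i : Fin 3) :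
    M u i = u 0 * M (e 0) i + u 1 * M (e 1) i + u 2 * M (e 2) i := by
  have hu : u = u 0 • e 0 + u 1 • e 1 + u 2 • e 2 := by
    ext j
    fin_cases j <;> simp [e]
  conv_lhs => rw [hu]
  simp only [map_add, map_smul, PiLp.add_apply, PiLp.smul_apply, smul_eq_mul]

/-- the quadratic form of a linear map in coordinates. -/
private theorem inner_clm_apply_coord (M : E3 →L[ℝ] E3) (u w : E3) :
    ⟪M u, w⟫_ℝ = ∑ i : Fin 3, ∑ j : Fin 3, u j * w i * M (e j) i := by
  rw [real_inner_e3]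
  simp only [Fin.sum_univ_three, clm_apply_coord' M u]
  ring

set_option maxRecDepth 8000 in
/-- TRACE IN THE FRAME: for every linear `M`, `‖y‖²‖R‖² tr M = ‖R‖²⟪My,y⟫ + ⟪Mτ,τ⟫ + ‖y‖²⟪MR,R⟫`. -/
theorem frame_trace (M : E3 →L[ℝ] E3) :
    (⟪y, y⟫_ℝ * ⟪cross y g, cross y g⟫_ℝ) * ∑ i : Fin 3, ⟪M (e i), e i⟫_ℝ =
      ⟪cross y g, cross y g⟫_ℝ * ⟪M y, y⟫_ℝ
        + ⟪M (cross (cross y g) y), cross (cross y g) y⟫_ℝ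
        + ⟪y, y⟫_ℝ * ⟪M (cross y g), cross y g⟫_ℝ := by
  rw [inner_clm_apply_coord M y y, inner_clm_apply_coord M (cross (cross y g) y) (cross (cross y g) y),
    inner_clm_apply_coord M (cross y g) (cross y g)]
  simp only [Fin.sum_univ_three]
  rw [inner_e_right, inner_e_right, inner_e_right, real_inner_e3 y y, real_inner_e3 (cross y g) (cross y g)]
  simp only [cross_apply_zero, cross_apply_one, cross_apply_two]
  ring

/-- VANISHING OF A CROSS PRODUCT read in the frame: two vectors orthogonal to `R ≠ 0` with proportional `(y, τ)`-components
have zero cross product. -/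
theorem cross_eq_zero_of_frame {X Z : E3} (hR : cross y g ≠ 0) (hX : ⟪X, cross y g⟫_ℝ = 0) (hZ : ⟪Z, cross y g⟫_ℝ = 0)
    (hprop : ⟪X, y⟫_ℝ * ⟪Z, cross (cross y g) y⟫_ℝ = ⟪X, cross (cross y g) y⟫_ℝ * ⟪Z, y⟫_ℝ) :
    cross X Z = 0 := by
  set R := cross y g with hRdef
  set τ := cross (cross y g) y with hτ
  have hρ : 0 < ⟪R, R⟫_ℝ := real_inner_self_pos.mpr hR
  have hy : y ≠ 0 := by
    rintro rfl
    apply hR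
    ext i
    fin_cases i <;> simp [hRdef, cross_apply_zero, cross_apply_one, cross_apply_two]
  have hr2 : 0 < ⟪y, y⟫_ℝ := real_inner_self_pos.mpr hy
  have hXr := frame_resolution y g X
  have hZr := frame_resolution y g Z
  rw [hX, mul_zero, zero_smul, add_zero] at hXr
  rw [hZ, mul_zero, zero_smul, add_zero] at hZr
  -- `(‖y‖²‖R‖²)² (X × Z) = ρ (Xy Zτ − Xτ Zy) (y × τ) = 0`
  have key : (⟪y, y⟫_ℝ * ⟪R, R⟫_ℝ) ^ 2 • cross X Z = 0 := by
    rw [pow_two, mul_smul, ← cross_smul_right', ← cross_smul_left', hXr, hZr, cross_lincomb]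
    have : ⟪cross y g, cross y g⟫_ℝ * ⟪X, y⟫_ℝ * ⟪Z, cross (cross y g) y⟫_ℝ -
        ⟪X, cross (cross y g) y⟫_ℝ * (⟪cross y g, cross y g⟫_ℝ * ⟪Z, y⟫_ℝ) = 0 := by
      rw [← hτ, ← hRdef]
      linear_combination ⟪R, R⟫_ℝ * hprop
    rw [this, zero_smul]
  have hne : (⟪y, y⟫_ℝ * ⟪R, R⟫_ℝ) ^ 2 ≠ 0 := by positivity
  exact (smul_eq_zero.mp key).resolve_left hne

end Frame

/-! ## Two more exact identities -/

/-- `‖R‖² X − ⟪X,R⟫ R = ⟪X,g⟫ (R × y) − ⟪X,y⟫ (R × g)` for `R = y × g` (BAC–CAB twice). -/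
theorem frame_eigen_identity (y g X : E3) :
    ⟪cross y g, cross y g⟫_ℝ • X - ⟪X, cross y g⟫_ℝ • cross y g =
      ⟪X, g⟫_ℝ • cross (cross y g) y - ⟪X, y⟫_ℝ • cross (cross y g) g := by
  rw [real_inner_e3 (cross y g) (cross y g), real_inner_e3 X (cross y g), real_inner_e3 X g, real_inner_e3 X y,
    cross_apply_zero, cross_apply_one, cross_apply_two]
  ext i
  fin_cases i <;> simp [cross_apply_zero, cross_apply_one, cross_apply_two] <;> ring

end Summit.NavierStokesRegularity.NavierStokesRegularity.Theorems.UnthreadedRigidity.VirialHorn
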